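import Literature.NumberTheory.Transcendental.AnalytificationConnected
import HarnessLib

/-!
# Complex-dense ⇒ Zariski-dense: the points of a dense subset of `X(ℂ)` are Zariski dense in `X`

Topic: `Literature/AlgebraicGeometry/Motives` (sequel of `ComplexPointsOpenDense`; complex points `X(ℂ) = ComplexPoints X` with the
strong topology of `Literature/NumberTheory/Transcendental/Analytification`).  For a scheme `X` locally of finite type over `ℂ` and a
subset `S ⊆ X(ℂ)` which is DENSE IN THE COMPLEX (strong) TOPOLOGY, the set of underlying scheme points `{P.pt : P ∈ S}` is ZARISKI
DENSE in `X`.  Proof: `pt : X(ℂ) → X` is continuous for strong → Zariski (`AlgPoints.isOpen_setOf_pt_mem`), so the Zariski closure of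
`pt(S)` contains `pt(closure S) = pt(X(ℂ)) =` the closed points of `X` (Nullstellensatz, `ComplexPoints.range_pt`), which are dense
because `X` is Jacobson (Mathlib `closure_closedPoints`).  Corollaries: a Zariski-closed subset containing `pt(S)` is everything; the
`DenseRange` form for families of complex points.  This is the «a fortiori, for the Zariski topology» step of [Milne 2005] Lemma 13.5
/ [Deligne 1971] 5.2 (complex density of a Hecke orbit ⇒ Zariski density), isolated as a generic tool (cell hodgecm-mathlib, I-1′
planning line `F1ExtHodgeType` v2, stub S5, input (Z1)).  Theorems only.

References: J. S. Milne, *Introduction to Shimura varieties* (2005), Lemma 13.5 p. 118 («dense for the complex topology and, a fortiori,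
for the Zariski topology») [Milne2005ShimuraVarieties]; U. Görtz, T. Wedhorn, *Algebraic Geometry I*, Prop. 3.35 (closed points very
dense) [GortzWedhorn2020]; D. Mumford, *Red Book*, I §10.  HC_CM is proved only modulo the 7 printed citations until rung 0 closes;
banked generic leaf toward I-1′ (XL), no floor change.
-/

noncomputable section

open AlgebraicGeometry Topology

namespace Literature.AlgebraicGeometry.Motives

variable {X : SchemeOver ℂ}

/-- The underlying-point map `X(ℂ) → X` is continuous from the strong (complex) topology to the Zariski topology (the strong
topology refines the pull-back of the Zariski topology: `AlgPoints.isOpen_setOf_pt_mem`). [cite: Milne2005ShimuraVarieties, Lemma 13.5 p. 118 (proof)] -/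
theorem ComplexPoints.continuous_pt : Continuous (AlgPoints.pt : ComplexPoints X → X.left) :=
  continuous_def.2 fun U hU => AlgPoints.isOpen_setOf_pt_mem (X := X) (L := ℂ) ⟨U, hU⟩

/-- **Complex-dense ⇒ Zariski-dense.**  For `X` locally of finite type over `ℂ` and `S ⊆ X(ℂ)` dense in the complex topology, the
underlying points `{P.pt : P ∈ S}` are dense in `X` (Zariski topology): the Zariski closure contains `pt(X(ℂ)) =` the closed points,
which are dense (`X` is Jacobson). [cite: Milne2005ShimuraVarieties, Lemma 13.5 p. 118] [cite: GortzWedhorn2020, Prop. 3.35] -/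
theorem dense_image_pt_of_dense [LocallyOfFiniteType X.hom] {S : Set (ComplexPoints X)} (hS : Dense S) :
    Dense (AlgPoints.pt '' S : Set X.left) := by
  haveI : JacobsonSpace ↥X.left := LocallyOfFiniteType.jacobsonSpace X.hom
  rw [dense_iff_closure_eq, Set.eq_univ_iff_forall]
  -- the Zariski closure of `pt(S)` contains every closed point
  have hclosed : closedPoints X.left ⊆ closure (AlgPoints.pt '' S) := by
    rw [← ComplexPoints.range_pt (X := X), ← Set.image_univ, ← hS.closure_eq]
    exact image_closure_subset_closure_image ComplexPoints.continuous_pt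
  -- and the closed points are dense
  have huniv : closure (closedPoints ↥X.left) ⊆ closure (AlgPoints.pt '' S) :=
    isClosed_closure.closure_subset_iff.mpr hclosed
  rw [closure_closedPoints] at huniv
  exact fun x => huniv (Set.mem_univ x)

/-- `DenseRange` form: if a family of complex points `u : ι → X(ℂ)` has dense range in the complex topology, the family of
underlying points has dense range in the Zariski topology. [cite: Milne2005ShimuraVarieties, Lemma 13.5 p. 118] -/
theorem denseRange_pt_comp_of_denseRange [LocallyOfFiniteType X.hom] {ι : Type*} {u : ι → ComplexPoints X} (hu : DenseRange u) :
    DenseRange (fun i => (u i).pt : ι → X.left) := by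
  have h := dense_image_pt_of_dense (X := X) hu
  rw [← Set.range_comp] at h
  exact h

/-- **A Zariski-closed subset of `X` containing the points of a complex-dense subset of `X(ℂ)` is everything.**
[cite: Milne2005ShimuraVarieties, Lemma 13.5 p. 118] [cite: GortzWedhorn2020, Prop. 3.35] -/
theorem eq_univ_of_isClosed_of_image_pt_subset [LocallyOfFiniteType X.hom] {S : Set (ComplexPoints X)} (hS : Dense S)
    {Z : Set X.left} (hZ : IsClosed Z) (h : AlgPoints.pt '' S ⊆ Z) : Z = Set.univ := by
  have hd := (dense_image_pt_of_dense (X := X) hS).closure_eq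
  rw [← Set.univ_subset_iff, ← hd]
  exact hZ.closure_subset_iff.mpr h

/-- Pointwise form: under the same hypotheses every point of `X` lies in the Zariski closure of `{P.pt : P ∈ S}`; in particular a
closed subset containing `P.pt` for all `P ∈ S` contains every point. [cite: Milne2005ShimuraVarieties, Lemma 13.5 p. 118] -/
theorem mem_of_isClosed_of_forall_pt_mem [LocallyOfFiniteType X.hom] {S : Set (ComplexPoints X)} (hS : Dense S)
    {Z : Set X.left} (hZ : IsClosed Z) (h : ∀ P ∈ S, P.pt ∈ Z) (x : X.left) : x ∈ Z := by
  have := eq_univ_of_isClosed_of_image_pt_subset hS hZ (by rintro _ ⟨P, hP, rfl⟩; exact h P hP)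
  rw [this]
  exact Set.mem_univ x

end Literature.AlgebraicGeometry.Motives

end
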